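import Mathlib
import HarnessLib
import Literature.NumberTheory.Sieve.IwaniecAlmostPrimesRhoMeanValue
import Summits.RiemannHypothesis.RiemannHypothesis.Theorems.ScrewLemmaKCoprofileSquareIntegrable
import Summits.RiemannHypothesis.RiemannHypothesis.Theorems.ScrewLemmaKExtremalRayDefs
import Summits.RiemannHypothesis.RiemannHypothesis.Theorems.ScrewLemmaKExtremalRayGramRay

/-!
# Route `ScrewLemmaKExtremalRay` — MÖBIUS INVERSION for the dilation operator: `A φ* = r` on `(0,1]`

With `(Aφ)(t) = Σ_{n ≤ 1/t} φ(nt)/n` and `φ*(u) = Σ_{k ≤ 1/u} μ(k) r(ku)/k` one has, for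
`0 < t ≤ 1`, `(Aφ*)(t) = Σ_{m ≤ 1/t} r(mt)/m · Σ_{k ∣ m} μ(k) = r(t)` (hyperbola rearrangement of the
double sum over `nk = m`, then `Σ_{k ∣ m} μ(k) = [m = 1]`, the tree's
`Literature.NumberTheory.Sieve.Iwaniec1978.sum_divisors_moebius_eq_ite`).  Also:
`|φ*(u)| ≤ 5(1 + log(1/u))` on `(0,1)`, `φ*` is measurable and square-integrable on `(0,1)`.
Inputs of crux E1 `NearExtremalGenerators` (stmt-RiemannHypothesis-22262).  RH-free; nothing here
bears on the truth of RH.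
-/

set_option linter.dupNamespace false

noncomputable section

namespace Summit.RiemannHypothesis.RiemannHypothesis.Theorems.ScrewLemmaKExtremalRay

open MeasureTheory Set
open Summit.RiemannHypothesis.RiemannHypothesis.Theorems.ScrewLemmaKCoprofile
  (sum_Icc_inv_le_one_add_log one_add_log_inv_le_rpow)

/-- HYPERBOLA REARRANGEMENT: `Σ_{n ≤ N} Σ_{k ≤ N/n} f(n,k) = Σ_{m ≤ N} Σ_{nk = m} f(n,k)`.
[folklore] -/
theorem sum_Icc_sum_Icc_div_eq {M : Type*} [AddCommMonoid M] (N : ℕ) (f : ℕ → ℕ → M) :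
    ∑ n ∈ Finset.Icc 1 N, ∑ k ∈ Finset.Icc 1 (N / n), f n k
      = ∑ m ∈ Finset.Icc 1 N, ∑ p ∈ m.divisorsAntidiagonal, f p.1 p.2 := by
  classical
  have hL : ∑ n ∈ Finset.Icc 1 N, ∑ k ∈ Finset.Icc 1 (N / n), f n k
      = ∑ p ∈ ((Finset.Icc 1 N ×ˢ Finset.Icc 1 N).filter (fun p : ℕ × ℕ => p.1 * p.2 ≤ N)),
          f p.1 p.2 := by
    rw [Finset.sum_filter, Finset.sum_product]
    refine Finset.sum_congr rfl fun n hn => ?_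
    rw [Finset.mem_Icc] at hn
    rw [← Finset.sum_filter]
    refine Finset.sum_congr ?_ fun _ _ => rfl
    ext k
    simp only [Finset.mem_Icc, Finset.mem_filter]
    rw [Nat.le_div_iff_mul_le (by omega)]
    constructor
    · rintro ⟨h1, h2⟩
      refine ⟨⟨h1, le_trans ?_ h2⟩, by rw [mul_comm]; exact h2⟩
      exact Nat.le_mul_of_pos_right k (by omega)
    · rintro ⟨⟨h1, _⟩, h3⟩
      exact ⟨h1, by rw [mul_comm]; exact h3⟩
  have hdisj : Set.PairwiseDisjoint (↑(Finset.Icc 1 N) : Set ℕ) Nat.divisorsAntidiagonal := by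
    intro a _ b _ hab
    rw [Function.onFun, Finset.disjoint_left]
    intro p hpa hpb
    rw [Nat.mem_divisorsAntidiagonal] at hpa hpb
    exact hab (hpa.1.symm.trans hpb.1)
  rw [hL, ← Finset.sum_biUnion hdisj]
  refine Finset.sum_congr ?_ fun _ _ => rfl
  ext ⟨a, b⟩
  simp only [Finset.mem_filter, Finset.mem_product, Finset.mem_Icc, Finset.mem_biUnion,
    Nat.mem_divisorsAntidiagonal]
  constructor
  · rintro ⟨⟨⟨ha1, _⟩, ⟨hb1, _⟩⟩, hab⟩
    refine ⟨a * b, ⟨?_, hab⟩, rfl, ?_⟩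
    · calc 1 = 1 * 1 := by ring
        _ ≤ a * b := Nat.mul_le_mul ha1 hb1
    · positivity
  · rintro ⟨m, ⟨_, hmN⟩, hab, hm0⟩
    have ha0 : 0 < a := by
      rcases Nat.eq_zero_or_pos a with h | h
      · exact absurd (by rw [← hab, h, zero_mul]) hm0
      · exact h
    have hb0 : 0 < b := by
      rcases Nat.eq_zero_or_pos b with h | h
      · exact absurd (by rw [← hab, h, mul_zero]) hm0
      · exact h
    refine ⟨⟨⟨ha0, ?_⟩, ⟨hb0, ?_⟩⟩, by rw [hab]; exact hmN⟩
    · calc a ≤ a * b := Nat.le_mul_of_pos_right a hb0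
        _ = m := hab
        _ ≤ N := hmN
    · calc b ≤ a * b := Nat.le_mul_of_pos_left b ha0
        _ = m := hab
        _ ≤ N := hmN

/-- Floor bookkeeping: `⌊1/(n t)⌋ = ⌊1/t⌋ / n`. [folklore] -/
theorem floor_one_div_mul (n : ℕ) (t : ℝ) : ⌊1 / ((n:ℝ) * t)⌋₊ = ⌊1 / t⌋₊ / n := by
  rw [← Nat.floor_div_natCast, div_div, mul_comm]

/-- **MÖBIUS INVERSION**: `(Aφ*)(t) = r(t)` for `0 < t ≤ 1`. [folklore] -/
theorem coprofileOp_moebiusRay {t : ℝ} (ht : t ∈ Set.Ioc (0:ℝ) 1) :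
    coprofileOp moebiusRay t = gramRay t := by
  have ht0 : 0 < t := ht.1
  set N := ⌊1 / t⌋₊ with hN
  have hN1 : 1 ≤ N := by
    rw [hN, Nat.one_le_floor_iff (1 / t), le_div_iff₀ ht0, one_mul]
    exact ht.2
  unfold coprofileOp
  rw [← hN]
  have step1 : ∀ n ∈ Finset.Icc 1 N, moebiusRay (n * t) / n
      = ∑ k ∈ Finset.Icc 1 (N / n),
          (ArithmeticFunction.moebius k : ℝ) * gramRay (k * (n * t)) / k / n := by
    intro n _
    unfold moebiusRay
    rw [floor_one_div_mul n t, ← hN, Finset.sum_div]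
  rw [Finset.sum_congr rfl step1,
    sum_Icc_sum_Icc_div_eq N
      (fun n k => (ArithmeticFunction.moebius k : ℝ) * gramRay (k * (n * t)) / k / n)]
  have step2 : ∀ m ∈ Finset.Icc 1 N,
      ∑ p ∈ m.divisorsAntidiagonal,
          (ArithmeticFunction.moebius p.2 : ℝ) * gramRay (p.2 * (p.1 * t)) / p.2 / p.1
        = gramRay (m * t) / m * ∑ d ∈ m.divisors, (ArithmeticFunction.moebius d : ℝ) := by
    intro m hm
    rw [Finset.mem_Icc] at hm
    rw [Nat.sum_divisorsAntidiagonal'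
      (fun a b => (ArithmeticFunction.moebius b : ℝ) * gramRay (b * (a * t)) / b / a),
      Finset.mul_sum]
    refine Finset.sum_congr rfl fun d hd => ?_
    have hdm : d ∣ m := Nat.dvd_of_mem_divisors hd
    have hd0 : d ≠ 0 := Nat.pos_iff_ne_zero.mp (Nat.pos_of_mem_divisors hd)
    have hq0 : m / d ≠ 0 := (Nat.div_ne_zero_iff_of_dvd hdm).mpr ⟨by omega, hd0⟩
    have hcast : ((m / d : ℕ) : ℝ) * (d : ℝ) = (m : ℝ) := by
      exact_mod_cast Nat.div_mul_cancel hdm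
    have hd0' : (d : ℝ) ≠ 0 := by exact_mod_cast hd0
    have hq0' : ((m / d : ℕ) : ℝ) ≠ 0 := by exact_mod_cast hq0
    have hm0' : (m : ℝ) ≠ 0 := by exact_mod_cast (show m ≠ 0 by omega)
    have harg : (d : ℝ) * (((m / d : ℕ) : ℝ) * t) = (m : ℝ) * t := by
      rw [← mul_assoc, mul_comm (d : ℝ), hcast]
    rw [harg]
    field_simp
    rw [← hcast]
    ring
  rw [Finset.sum_congr rfl step2]
  simp_rw [Literature.NumberTheory.Sieve.Iwaniec1978.sum_divisors_moebius_eq_ite, mul_ite, mul_one,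
    mul_zero]
  rw [Finset.sum_ite_eq' (Finset.Icc 1 N) 1 (fun m => gramRay (m * t) / m)]
  rw [if_pos (Finset.mem_Icc.mpr ⟨le_refl 1, hN1⟩)]
  simp

/-- The lattice points `n u`, `n ≤ ⌊1/u⌋`, lie in `[0,1]` for `0 < u`. [folklore] -/
theorem natMul_mem_Icc {u : ℝ} (hu : 0 < u) {n : ℕ} (hn : n ∈ Finset.Icc 1 ⌊1 / u⌋₊) :
    (n : ℝ) * u ∈ Set.Icc (0:ℝ) 1 := by
  rw [Finset.mem_Icc] at hn
  refine ⟨by positivity, ?_⟩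
  have h2 : (n:ℝ) ≤ ⌊1 / u⌋₊ := by exact_mod_cast hn.2
  have h3 : (⌊1 / u⌋₊ : ℝ) ≤ 1 / u := Nat.floor_le (by positivity)
  calc (n:ℝ) * u ≤ (1 / u) * u := mul_le_mul_of_nonneg_right (h2.trans h3) hu.le
    _ = 1 := by field_simp

/-- LOG BOUND: `|φ*(u)| ≤ 5(1 + log(1/u))` for `u ∈ (0,1)` (`|μ| ≤ 1`, `|r| ≤ 5`, harmonic sum).
[folklore] -/
theorem abs_moebiusRay_le {u : ℝ} (hu : u ∈ Set.Ioo (0:ℝ) 1) :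
    |moebiusRay u| ≤ 5 * (1 + Real.log (1 / u)) := by
  have hu0 : 0 < u := hu.1
  have h1u : 1 ≤ 1 / u := by rw [le_div_iff₀ hu0]; linarith [hu.2]
  have hN1 : 1 ≤ ⌊1 / u⌋₊ := (Nat.one_le_floor_iff _).mpr h1u
  have hNpos : (0:ℝ) < (⌊1 / u⌋₊ : ℝ) := by exact_mod_cast hN1
  have hNle : (⌊1 / u⌋₊ : ℝ) ≤ 1 / u := Nat.floor_le (by positivity)
  unfold moebiusRay
  calc |∑ n ∈ Finset.Icc 1 ⌊1 / u⌋₊,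
          (ArithmeticFunction.moebius n : ℝ) * gramRay (n * u) / n|
      ≤ ∑ n ∈ Finset.Icc 1 ⌊1 / u⌋₊,
          |(ArithmeticFunction.moebius n : ℝ) * gramRay (n * u) / n| := Finset.abs_sum_le_sum_abs _ _
    _ ≤ ∑ n ∈ Finset.Icc 1 ⌊1 / u⌋₊, 5 * ((1 : ℝ) / n) := by
        refine Finset.sum_le_sum fun n hn => ?_
        have hmem := natMul_mem_Icc hu0 hn
        rw [Finset.mem_Icc] at hn
        have hnpos : (0:ℝ) < n := by exact_mod_cast hn.1
        have hμ : |(ArithmeticFunction.moebius n : ℝ)| ≤ 1 := by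
          exact_mod_cast ArithmeticFunction.abs_moebius_le_one
        have hr : |gramRay (n * u)| ≤ 5 := abs_gramRay_le hmem
        rw [abs_div, abs_mul, Nat.abs_cast]
        rw [div_le_iff₀ hnpos]
        calc |(ArithmeticFunction.moebius n : ℝ)| * |gramRay (n * u)| ≤ 1 * 5 :=
              mul_le_mul hμ hr (abs_nonneg _) zero_le_one
          _ = 5 * (1 / (n:ℝ)) * n := by field_simp
    _ = 5 * ∑ n ∈ Finset.Icc 1 ⌊1 / u⌋₊, (1 : ℝ) / n := by rw [Finset.mul_sum]
    _ ≤ 5 * (1 + Real.log (⌊1 / u⌋₊ : ℝ)) :=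
        mul_le_mul_of_nonneg_left (sum_Icc_inv_le_one_add_log hN1) (by norm_num)
    _ ≤ 5 * (1 + Real.log (1 / u)) :=
        mul_le_mul_of_nonneg_left (by linarith [Real.log_le_log hNpos hNle]) (by norm_num)

/-- The truncated Möbius sums `Σ_{n ≤ N} μ(n) r(nx)/n` are continuous in `x`. [folklore] -/
theorem continuous_moebiusPartial (N : ℕ) :
    Continuous fun x : ℝ => ∑ n ∈ Finset.Icc 1 N,
      (ArithmeticFunction.moebius n : ℝ) * gramRay (n * x) / n := by
  refine continuous_finsetSum _ fun n _ => ?_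
  have h1 : Continuous fun x : ℝ => gramRay (n * x) :=
    continuous_gramRay.comp (continuous_const.mul continuous_id)
  exact (continuous_const.mul h1).div_const _

/-- `φ*` is measurable (countable gluing of continuous finite sums). [folklore] -/
theorem measurable_moebiusRay : Measurable moebiusRay := by
  have hP : Measurable fun p : ℝ × ℕ =>
      ∑ n ∈ Finset.Icc 1 p.2, (ArithmeticFunction.moebius n : ℝ) * gramRay (n * p.1) / n := by
    refine measurable_from_prod_countable_left fun N => ?_
    exact (continuous_moebiusPartial N).measurable
  have hN : Measurable fun u : ℝ => ⌊1 / u⌋₊ :=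
    Nat.measurable_floor.comp (measurable_const.div measurable_id)
  have h := hP.comp (measurable_id.prodMk hN)
  exact h

/-- `φ* ∈ L²(0,1)`: `φ*² ≤ 625·u^{−1/2}` on `(0,1)`, an integrable majorant. [folklore] -/
theorem memLp_two_moebiusRay : MemLp moebiusRay 2 (volume.restrict (Set.Ioo (0:ℝ) 1)) := by
  rw [memLp_two_iff_integrable_sq measurable_moebiusRay.aestronglyMeasurable]
  have hdom : IntegrableOn (fun u : ℝ => (25 : ℝ) ^ 2 * u ^ (-(1 / 2 : ℝ))) (Set.Ioo 0 1) := by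
    have h := (intervalIntegral.intervalIntegrable_rpow' (a := 0) (b := 1) (r := -(1 / 2 : ℝ))
      (by norm_num))
    rw [intervalIntegrable_iff_integrableOn_Ioo_of_le zero_le_one] at h
    exact h.const_mul _
  refine hdom.mono' ((measurable_moebiusRay.pow_const 2).aestronglyMeasurable) ?_
  rw [ae_restrict_iff' measurableSet_Ioo]
  refine Filter.Eventually.of_forall fun u hu => ?_
  have hb := abs_moebiusRay_le hu
  have hl := one_add_log_inv_le_rpow hu
  have h5 : |moebiusRay u| ≤ 25 * u ^ (-(1 / 4 : ℝ)) := by nlinarith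
  have hpos : 0 ≤ u ^ (-(1 / 4 : ℝ)) := Real.rpow_nonneg hu.1.le _
  have hsq : (u ^ (-(1 / 4 : ℝ))) ^ 2 = u ^ (-(1 / 2 : ℝ)) := by
    rw [← Real.rpow_natCast, ← Real.rpow_mul hu.1.le]; norm_num
  rw [Real.norm_eq_abs, abs_pow, ← hsq, ← mul_pow]
  exact pow_le_pow_left₀ (abs_nonneg _) h5 2

end Summit.RiemannHypothesis.RiemannHypothesis.Theorems.ScrewLemmaKExtremalRay

end
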